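import Summits.AtomisticToContinuum.HydrodynamicLimit.Theorems.CollisionIsometryCLTCollisionalTransferLocalityDefsB
import Summits.AtomisticToContinuum.HydrodynamicLimit.Theorems.CollisionIsometryCLTCollisionalTransferLocalityVirialGuard
import HarnessLib

/-!
# Audit lemmas for stub `stub_contactVirial` ([B-dyn], line hemisphere-affine-slaving, crux 9518)

Sorry-free bookkeeping facts found during the statement audit of the EOS-free cut [B-dyn]
`ContactVirial … (pOf Y σ)` (stub worker of the lead prover-line-stmt-AtomisticToContinuum-9518-c2-0;
census `work/stubs/stub_contactVirial.md`). They are the `pOf`-analogues of the landed `pcoll` guard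
lemmas (`CollisionIsometryCLTCollisionalTransferLocalityVirialGuard`): for EVERY value function `Y`

* `pOf_rhoB_thetaB_eq` : at the block fields `p_Y(ρ̄, θ̄) = pkin · Y(ρ̄σ³)/6`;
* `pOf_eq_zero_of_pkin_eq_zero` : the guard of `affW` is matched by `p_Y`: `pkin = 0 → p_Y(ρ̄, θ̄) = 0`;
* `pOf_zero_density` : `p_Y(0, θ) = 0` whatever the (unpinned) value `Y 0`;
* `kinW_mul_pOf` : off guarded blocks the factor `1/pkin` of `kinW` cancels EXACTLY against `p_Y`:
  `kinW · p_Y(ρ̄, θ̄) = (Y(ρ̄σ³)/6) · [(2/5)(D:∇ψ + Dū·∇χ) + (3/5) q·∇χ]` (no `1/pkin` left — the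
  integrability remark of the audit, item (c));
* `eulerW_mul_pOf_add_kinW_mul_pOf` : pointwise `eulerW·p_Y + kinW·p_Y = 3·affW·p_Y`, i.e. the
  integrands of `RhsG + KfunG` at `p := pOf Y σ` add up to `p_Y` tested against `3·affW` with NO junk
  discrepancy from the guard (so `ContactVirial … (pOf Y σ)` IS "slaved collision sum `S_N` =
  `∫∫ 3·affW·p_Y(ρ̄, θ̄)`" up to Bochner additivity on the good event).
-/

namespace Summit.AtomisticToContinuum.HydrodynamicLimit.Theorems.HemisphereAffineSlaving

open scoped BigOperators Topology Classical MeasureTheory ENNReal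
open Filter Set Function MeasureTheory

noncomputable section

open Literature.MathematicalPhysics.KineticTheory (T3 V3)

/-- At the block fields: `p_Y(ρ̄, θ̄) = pkin · Y(ρ̄σ³)/6`. [folklore] -/
theorem pOf_rhoB_thetaB_eq (Y : ℝ → ℝ) (σ : ℝ) (φ : ℕ → T3 → ℝ) (N : ℕ) (z : Cfg N) (x : T3) :
    pOf Y σ (rhoB φ N z x) (thetaB φ N z x) = pkin φ N z x * Y (rhoB φ N z x * σ ^ 3) / 6 := by
  rw [pOf, pkin]

/-- The guard of `affW` is matched by `p_Y`: `pkin = 0 → p_Y(ρ̄, θ̄) = 0`. [folklore] -/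
theorem pOf_eq_zero_of_pkin_eq_zero (Y : ℝ → ℝ) (σ : ℝ) {φ : ℕ → T3 → ℝ} {N : ℕ} {z : Cfg N} {x : T3}
    (h : pkin φ N z x = 0) : pOf Y σ (rhoB φ N z x) (thetaB φ N z x) = 0 := by
  rw [pOf_rhoB_thetaB_eq, h, zero_mul, zero_div]

/-- Junk-free at empty blocks: `p_Y(0, θ) = 0` whatever the value `Y 0` (which `StaticShell` does
not pin). [folklore] -/
theorem pOf_zero_density (Y : ℝ → ℝ) (σ th : ℝ) : pOf Y σ 0 th = 0 := by
  simp [pOf]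

/-- Off guarded blocks the `1/pkin` of `kinW` cancels exactly against `p_Y = pkin · Y/6`:
`kinW · p_Y(ρ̄, θ̄) = (Y(ρ̄σ³)/6)·[(2/5)(D:∇ψ + Dū·∇χ) + (3/5) q·∇χ]`. [folklore] -/
theorem kinW_mul_pOf (Y : ℝ → ℝ) (σ : ℝ) (ψ : ℝ → T3 → V3) (χ : ℝ → T3 → ℝ) (φ : ℕ → T3 → ℝ)
    (N : ℕ) (s : ℝ) (z : Cfg N) (x : T3) (h : pkin φ N z x ≠ 0) :
    kinW ψ χ φ N s z x * pOf Y σ (rhoB φ N z x) (thetaB φ N z x) =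
      Y (rhoB φ N z x * σ ^ 3) / 6 *
        (2 / 5 * ((∑ a, ∑ b, Dst φ N z x a b * gradPsi ψ s x a b) +
            (∑ a, ∑ b, Dst φ N z x a b * uB φ N z x b * gradChi χ s x a)) +
          3 / 5 * (∑ a, qfl φ N z x a * gradChi χ s x a)) := by
  rw [pOf_rhoB_thetaB_eq, kinW]
  field_simp

/-- Pointwise, the integrands of `RhsG` and `KfunG` at `p := pOf Y σ` add up to `3 · affW · p_Y` —
on guarded blocks (`pkin = 0`) both sides vanish, elsewhere `affW = (eulerW + kinW)/3`. [folklore] -/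
theorem eulerW_mul_pOf_add_kinW_mul_pOf : ∀ (Y : ℝ → ℝ) (σ : ℝ) (ψ : ℝ → T3 → V3) (χ : ℝ → T3 → ℝ) (φ : ℕ → T3 → ℝ) (N : ℕ) (s : ℝ) (z : Cfg N) (x : T3), eulerW ψ χ φ N s z x * pOf Y σ (rhoB φ N z x) (thetaB φ N z x) + kinW ψ χ φ N s z x * pOf Y σ (rhoB φ N z x) (thetaB φ N z x) = 3 * affW ψ χ φ N s z x * pOf Y σ (rhoB φ N z x) (thetaB φ N z x) := by
  intro Y σ ψ χ φ N s z x
  unfold affW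
  split_ifs with h
  · rw [pOf_eq_zero_of_pkin_eq_zero Y σ h]
    ring
  · ring

/-- Consistency with the landed `pcoll` guard lemma: at `Y := ZPi` the statement above is
`eulerW_mul_pcoll_add_kinW_mul_pcoll` (via `pOf_ZPi`). [folklore] -/
theorem eulerW_mul_pOf_add_kinW_mul_pOf_ZPi (σ : ℝ) (ψ : ℝ → T3 → V3) (χ : ℝ → T3 → ℝ)
    (φ : ℕ → T3 → ℝ) (N : ℕ) (s : ℝ) (z : Cfg N) (x : T3) :
    eulerW ψ χ φ N s z x * pcoll σ (rhoB φ N z x) (thetaB φ N z x) +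
        kinW ψ χ φ N s z x * pcoll σ (rhoB φ N z x) (thetaB φ N z x) =
      3 * affW ψ χ φ N s z x * pcoll σ (rhoB φ N z x) (thetaB φ N z x) := by
  simpa only [pOf_ZPi] using eulerW_mul_pOf_add_kinW_mul_pOf ZPi σ ψ χ φ N s z x

end

end Summit.AtomisticToContinuum.HydrodynamicLimit.Theorems.HemisphereAffineSlaving
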